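import Summits.BirchSwinnertonDyer.BirchSwinnertonDyer.Theses.AdditiveKolyvaginRoad
import Summits.BirchSwinnertonDyer.BirchSwinnertonDyer.Theorems.AdditiveKolyvaginRoadLevelSystemsOfFirstFloor
import HarnessLib

/-!
# Route `AdditiveKolyvaginRoad`, crux `LevelKolyvaginSystemsAdditive` (item stmt-BirchSwinnertonDyer-21396, KS′):
# the crux BY NAME from ONE displayed hypothesis in W. Zhang's CONGRUENCE form — even-level classes + (SRL) + first floor (FF)
# (cell `pub/bsd-wall`, width seat `bsd-wall-akr-p2x-w2` g0 on line `birth`; `--supports stmt-BirchSwinnertonDyer-21396`, helper;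
# the λ-free companion of `AdditiveKolyvaginRoadLevelSystemsOfBipartiteCrux`, over width seat w3's
# `AdditiveKolyvaginRoadLevelSystemsOfFirstFloor`)

WHAT. `levelKolyvaginSystemsAdditive_of_firstFloor`: the crux `LevelKolyvaginSystemsAdditive` FOLLOWS from ONE hypothesis displayed
in full: at every ♯ additive frame (the crux's own binders, VERBATIM) and complex conjugation `c ≠ 1`, there are signs `ε₀` and
classes `κ₀(m, n) ∈ H¹(K, E[p])` owed at the EVEN levels (realisation at `∅`; sign ∕ Kummer off the support ∕ toric on the level ∕
transverse on the conductor ∕ (8.1) at even non-empty levels) satisfying (SRL) the SECOND RECIPROCITY LAW in congruence form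
(W. Zhang Thm 4.3 (4.5): `loc_{v₁} κ₀(m, n) = 0 ⟺ loc_{v₂} κ₀(m, n∪{q₁,q₂}) = 0`) and (FF) the FIRST FLOOR (`Sel_{n∪q}⁺ = Sel_{n∪q}⁻ = ⊥
⟹ loc_v κ₀(∅, n) ≠ 0`, `v ∣ q`, `n` even non-empty: Thm 7.1 + Cor 6.2 ∕ Thm 6.4 + Thm 6.5 for `g_{n∪q}`). Proof = w3's
`nonempty_levelKolyvaginSystemP_of_reciprocity_of_firstFloor` ((A1) discharged there by the landed `stub_rankLoweringAdditive`).
This is the λ-FREE socket of the dictionary (crux dir `DICTIONARY-BIPARTITE.md`): (SRL) = (A⇐)+(B⇒) and (FF) = (γ)∘(A⇐) with the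
odd-level values eliminated.

HONEST FRAMING: one theorem; 0 definitions, 0 named facts, 0 `sorry`; CONDITIONAL on its displayed (decl-free) hypothesis; closes
nothing; dies only with a restate of KS′ itself (T9). BSD is not proved by any of this.

References: [cite: WZhang2014, §3, Thm. 4.3 (4.5), Prop. 5.4, Thm. 6.5, Thm. 7.1, Thm. 7.2, §8.1, §9] [cite: BertoliniDarmon2005,
Thm. 3.2, Thm. 9.2].
-/

-- single-conjunct summit: `Summit.BirchSwinnertonDyer.BirchSwinnertonDyer.…` repeats the name by design
set_option linter.dupNamespace false

noncomputable section

open scoped Classical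

namespace Summit.BirchSwinnertonDyer.BirchSwinnertonDyer.Theorems.AdditiveKoly

open WeierstrassCurve NumberField IsDedekindDomain
  Literature.NumberTheory.EllipticCurves Literature.NumberTheory.EllipticCurves.ModularForms
  Literature.NumberTheory.EllipticCurves.Rank1Residual Literature.NumberTheory.GaloisRepresentations Module
  Summit.BirchSwinnertonDyer.BirchSwinnertonDyer.Theses.AdditiveKolyvaginRoad

/-- **KS′ BY NAME FROM EVEN-LEVEL CLASSES + (SRL) + (FF).** If at every ♯ additive frame of the route and every complex conjugation
`c ≠ 1` there are signs `ε₀` and even-level classes `κ₀` with the realisation identity and the local Kolyvagin-system axioms at even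
non-empty levels, the second reciprocity law (SRL) in congruence form from even bottom levels, and the first floor (FF) at even
non-empty levels, then the crux `LevelKolyvaginSystemsAdditive` holds. [cite: WZhang2014, Thm. 4.3, Thm. 7.2, §9] -/
theorem levelKolyvaginSystemsAdditive_of_firstFloor
    (H : ∀ (W : WeierstrassCurve ℚ) [W.IsElliptic] [W.IsGloballyMinimal] [NeZero (W.conductorNorm ℤ)]
      (p : ℕ) [Fact p.Prime] (K : Type) [Field K] [NumberField K]
      (Dt : ModularParametrizationData W (W.conductorNorm ℤ)) (β : ℤ) (ι : K →+* ℂ),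
      5 ≤ p → Addv W p → W.HasSurjectiveModNGaloisRep p →
      (∀ (ℓ : ℕ) [Fact ℓ.Prime], W.HasMultiplicativeReductionAtPrime ℓ →
        ¬ p ∣ padicValInt ℓ W.minimalDiscriminantInt) →
      (∃ (ℓ₁ ℓ₂ : ℕ) (_ : Fact ℓ₁.Prime) (_ : Fact ℓ₂.Prime), ℓ₁ ≠ ℓ₂ ∧
        W.HasMultiplicativeReductionAtPrime ℓ₁ ∧ W.HasMultiplicativeReductionAtPrime ℓ₂) →
      ¬ p ∣ W.tamagawaProduct → W.analyticRank = 1 →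
      IsImaginaryQuadratic K → Odd (NumberField.discr K) → NumberField.discr K < -4 →
      SatisfiesHeegnerHypothesis (W.conductorNorm ℤ) K →
      (W.quadraticTwist (NumberField.discr K : ℚ)).entireLFunction 1 ≠ 0 →
      (4 * (W.conductorNorm ℤ : ℤ)) ∣ β ^ 2 - NumberField.discr K → ¬ (p : ℤ) ∣ Dt.c →
      ∀ (c : K ≃ₐ[ℚ] K), c ≠ 1 → ∀ [Module (ZMod p) (Vp W K p)],
      ∃ (ε₀ : Finset (AdmQ W K p) → Bool)
        (κ₀ : Finset {ℓ // Zhang2014.IsKolyvaginPrime (W.conductorNorm ℤ) W K p ℓ} → Finset (AdmQ W K p) → Vp W K p),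
        -- realisation at level `∅`
        (∀ m : Finset {ℓ // Zhang2014.IsKolyvaginPrime (W.conductorNorm ℤ) W K p ℓ},
          ∃ d : KolyvaginHeegnerData Dt β ι (∏ ℓ ∈ m, (ℓ : ℕ)), κ₀ m ∅ = d.kolyvaginClass (Fact.out : p.Prime) 1) ∧
        -- sign
        (∀ n : Finset (AdmQ W K p), n.Nonempty → Even n.card →
          ∀ m : Finset {ℓ // Zhang2014.IsKolyvaginPrime (W.conductorNorm ℤ) W K p ℓ},
          conjAct W c ((p ^ 1 : ℕ) : ℤ) (κ₀ m n) = sgnP (ε₀ n ^^ Nat.bodd m.card) • κ₀ m n) ∧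
        -- selmer_off
        (∀ n : Finset (AdmQ W K p), n.Nonempty → Even n.card →
          ∀ (m : Finset {ℓ // Zhang2014.IsKolyvaginPrime (W.conductorNorm ℤ) W K p ℓ}) (v : HeightOneSpectrum (𝓞 K)),
          (∀ ℓ ∈ m, ((ℓ : ℕ) : 𝓞 K) ∉ v.asIdeal) → (∀ q ∈ n, ((q : ℕ) : 𝓞 K) ∉ v.asIdeal) →
          κ₀ m n ∈ selmerLocalKer (W.baseChange K) (v.adicCompletion K) ((p ^ 1 : ℕ) : ℤ)) ∧
        -- selmer_inf
        (∀ n : Finset (AdmQ W K p), n.Nonempty → Even n.card →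
          ∀ (m : Finset {ℓ // Zhang2014.IsKolyvaginPrime (W.conductorNorm ℤ) W K p ℓ}) (w : InfinitePlace K),
          κ₀ m n ∈ selmerLocalKer (W.baseChange K) w.Completion ((p ^ 1 : ℕ) : ℤ)) ∧
        -- toric_on
        (∀ n : Finset (AdmQ W K p), n.Nonempty → Even n.card →
          ∀ m : Finset {ℓ // Zhang2014.IsKolyvaginPrime (W.conductorNorm ℤ) W K p ℓ}, ∀ q ∈ n,
          ∀ v : HeightOneSpectrum (𝓞 K), ((q : ℕ) : 𝓞 K) ∈ v.asIdeal →
          κ₀ m n ∈ toricLocalKer (W.baseChange K) (v.adicCompletion K) ((p ^ 1 : ℕ) : ℤ)) ∧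
        -- transverse_on
        (∀ n : Finset (AdmQ W K p), n.Nonempty → Even n.card →
          ∀ m : Finset {ℓ // Zhang2014.IsKolyvaginPrime (W.conductorNorm ℤ) W K p ℓ}, ∀ ℓ ∈ m,
          ∀ v : HeightOneSpectrum (𝓞 K), ((ℓ : ℕ) : 𝓞 K) ∈ v.asIdeal → κ₀ m n ∈ transverseLocalKerP W K p ι ℓ v) ∧
        -- relation (8.1)
        (∀ n : Finset (AdmQ W K p), n.Nonempty → Even n.card →
          ∀ (m : Finset {ℓ // Zhang2014.IsKolyvaginPrime (W.conductorNorm ℤ) W K p ℓ})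
            (ℓ : {ℓ // Zhang2014.IsKolyvaginPrime (W.conductorNorm ℤ) W K p ℓ}), ℓ ∉ m →
          ∀ v : HeightOneSpectrum (𝓞 K), ((ℓ : ℕ) : 𝓞 K) ∈ v.asIdeal →
          (κ₀ (insert ℓ m) n ∈ (W.baseChange K).torsionLocalKer (v.adicCompletion K) ((p ^ 1 : ℕ) : ℤ) ↔
            κ₀ m n ∈ (W.baseChange K).torsionLocalKer (v.adicCompletion K) ((p ^ 1 : ℕ) : ℤ))) ∧
        -- (SRL) second reciprocity law in congruence form (W. Zhang Thm 4.3 (4.5))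
        (∀ (n : Finset (AdmQ W K p)) (q₁ q₂ : AdmQ W K p), q₁ ∉ n → q₂ ∉ insert q₁ n → Even n.card →
          ∀ (m : Finset {ℓ // Zhang2014.IsKolyvaginPrime (W.conductorNorm ℤ) W K p ℓ}) (v₁ v₂ : HeightOneSpectrum (𝓞 K)),
          ((q₁ : ℕ) : 𝓞 K) ∈ v₁.asIdeal → ((q₂ : ℕ) : 𝓞 K) ∈ v₂.asIdeal →
          (κ₀ m n ∈ (W.baseChange K).torsionLocalKer (v₁.adicCompletion K) ((p ^ 1 : ℕ) : ℤ) ↔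
            κ₀ m (insert q₂ (insert q₁ n)) ∈ (W.baseChange K).torsionLocalKer (v₂.adicCompletion K) ((p ^ 1 : ℕ) : ℤ))) ∧
        -- (FF) the first floor at even non-empty levels
        (∀ n : Finset (AdmQ W K p), n.Nonempty → Even n.card →
          ∀ q : AdmQ W K p, q ∉ n → SelQP W K p c (insert q n) true = ⊥ → SelQP W K p c (insert q n) false = ⊥ →
          ∀ v : HeightOneSpectrum (𝓞 K), ((q : ℕ) : 𝓞 K) ∈ v.asIdeal →
          κ₀ ∅ n ∉ (W.baseChange K).torsionLocalKer (v.adicCompletion K) ((p ^ 1 : ℕ) : ℤ))) :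
    LevelKolyvaginSystemsAdditive := by
  intro W _ _ _ p _ K _ _ Dt β ι h5 hadd hsurj hsp htwo htam hr hK hodd hlt hH hL hβ hcM c hc1 _
  obtain ⟨ε₀, κ₀, hreal, hsign, hoff, hinf, htor, htr, hrel, hSRL, hFF⟩ :=
    H W p K Dt β ι h5 hadd hsurj hsp htwo htam hr hK hodd hlt hH hL hβ hcM c hc1
  exact nonempty_levelKolyvaginSystemP_of_reciprocity_of_firstFloor W K p c Dt β ι h5 hadd hsurj hsp htwo htam hr hK hodd
    hH hL hβ hcM hc1 ε₀ κ₀ hreal hsign hoff hinf htor htr hrel hSRL hFF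

end Summit.BirchSwinnertonDyer.BirchSwinnertonDyer.Theorems.AdditiveKoly

end
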